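import Summits.RiemannHypothesis.RiemannHypothesis.Theorems.PfPersistenceDialPincer
import HarnessLib

/-!
# Pf persistence — the near-lag law on SERVED windows: no rung hypothesis (cand-6, gen 9, file IV)

Mechanism/rigidity campaign; no RH claims.  Weight-free structural statements about the
finite-dimensional dial algebra; every premiss about a concrete table is DATA wherever it is asserted.

The near-lag up-dial splitting law (`PfPersistenceAutocorrSplitMid`) and the two-sided shape pincer
(`PfPersistenceDialPincer`) carry a RUNG hypothesis `win.a / m ≤ Real.log p` (`m = 1, 2, 3, 4`).  On
every window with `win.a ≤ 4 * Real.log 2` — this covers every window the campaign serves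
(`a ∈ {log 2, 1, log 3, 1.2, 1.5, 1.96, 2.3}`, all `≤ 4 log 2 ≈ 2.77`) — the quarter rung holds at
EVERY natural number `p ≥ 2`, hence at every prime power the dial can reach; and `0 < zetaWeights p`
already forces `2 ≤ p`.  So on served windows the law and the pincer hold at every reached prime
power with NO lag hypothesis at all, at the price of the golden ceiling `(1 + √5)/4`.

* `quarter_rung_of_two_le` — `win.a ≤ 4 log 2 → 2 ≤ p → win.a / 4 ≤ log p`.
* (tree) `two_le_of_zetaWeights_pos` — `0 < zetaWeights p → 2 ≤ p` (`PfPersistenceDialSpaceLeaf`).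
* `servedWindow_upDial_not_mem_floorNodelessOddAt_of_threshold`, `…EOAt…` — the odd-sector
  up-dial law at every `p ≥ 2` of a served window.
* `servedWindow_zeta_upDial_not_mem_floorNodelessEOAt_of_threshold`,
  `servedWindow_zeta_dial_mem_Icc_of_mem_floorNodelessEOAt` — ζ handles: every prime power `p`
  with `0 < zetaWeights p` reached by a served window, no rung hypothesis.
-/

set_option linter.dupNamespace false

namespace Summit.RiemannHypothesis.RiemannHypothesis.Theorems.PfPersistence

open Real Matrix

/-- On a window with `a ≤ 4 log 2` the quarter rung `a/4 ≤ log p` holds at every `p ≥ 2`. [folklore] -/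
theorem quarter_rung_of_two_le {win : Window} (ha : win.a ≤ 4 * Real.log 2) {p : ℕ} (h2 : 2 ≤ p) :
    win.a / 4 ≤ Real.log p := by
  have h : Real.log 2 ≤ Real.log p :=
    Real.log_le_log (by norm_num) (by exact_mod_cast h2)
  linarith

/-- SERVED-WINDOW ODD UP-DIAL LAW (no rung hypothesis): on a window with `a ≤ 4 log 2`, at any
`p ≥ 2` of `primeRange (2a)` with `0 ≤ w p`, one odd test vector `v ≠ 0` with level `≤ ℓ‖v‖²` and odd
lag-correlation `≥ τ‖v‖²`, `τ > (1+√5)/4 + 2φN`, rejects every up-dial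
`K − 1 > (ℓ − ε₁(Q⁻(w))) / (2 w(p) (τ − (1+√5)/4 − 2φN))` from the floored odd nodal reader. [folklore] -/
theorem servedWindow_upDial_not_mem_floorNodelessOddAt_of_threshold {win : Window} (ha : win.a ≤ 4 * Real.log 2)
    {p : ℕ} (hp : p ∈ primeRange (2 * win.a)) (h2 : 2 ≤ p) {K : ℝ} (hK : 1 ≤ K) {w : Weights} (hw : 0 ≤ w p)
    {φ : ℝ} (hφ : 0 ≤ φ) {v : Fin win.N → ℝ} (hv : v ≠ 0) {ℓ τ : ℝ}
    (hℓ : v ⬝ᵥ (oddBlock w win *ᵥ v) ≤ ℓ * (v ⬝ᵥ v))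
    (hτ : τ * (v ⬝ᵥ v) ≤ oddAutocorr (2 * win.a) v (Real.log p))
    (ht : ℓ - bottomRayleigh (oddBlock w win)
      < 2 * (K - 1) * w p * (τ - (1 + Real.sqrt 5) / 4 - 2 * φ * win.N)) :
    datumOf (dial p K w) ∉ floorNodelessOddAt φ win :=
  quarterUpDial_not_mem_floorNodelessOddAt_of_threshold hp (quarter_rung_of_two_le ha h2) hK hw hφ hv hℓ hτ ht

/-- The same law read on the full `eo` reader `floorNodelessEOAt = even ∩ odd`. [folklore] -/
theorem servedWindow_upDial_not_mem_floorNodelessEOAt_of_threshold {win : Window} (ha : win.a ≤ 4 * Real.log 2)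
    {p : ℕ} (hp : p ∈ primeRange (2 * win.a)) (h2 : 2 ≤ p) {K : ℝ} (hK : 1 ≤ K) {w : Weights} (hw : 0 ≤ w p)
    {φ : ℝ} (hφ : 0 ≤ φ) {v : Fin win.N → ℝ} (hv : v ≠ 0) {ℓ τ : ℝ}
    (hℓ : v ⬝ᵥ (oddBlock w win *ᵥ v) ≤ ℓ * (v ⬝ᵥ v))
    (hτ : τ * (v ⬝ᵥ v) ≤ oddAutocorr (2 * win.a) v (Real.log p))
    (ht : ℓ - bottomRayleigh (oddBlock w win)
      < 2 * (K - 1) * w p * (τ - (1 + Real.sqrt 5) / 4 - 2 * φ * win.N)) :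
    datumOf (dial p K w) ∉ floorNodelessEOAt φ win :=
  fun h => servedWindow_upDial_not_mem_floorNodelessOddAt_of_threshold ha hp h2 hK hw hφ hv hℓ hτ ht h.2

/-- ζ handle of the served-window up-dial law: at a prime power with `0 < zetaWeights p` (which forces
`2 ≤ p`) reached by a window with `a ≤ 4 log 2`, no lag hypothesis is needed. [folklore] -/
theorem servedWindow_zeta_upDial_not_mem_floorNodelessEOAt_of_threshold {win : Window} (ha : win.a ≤ 4 * Real.log 2)
    {p : ℕ} (hp : p ∈ primeRange (2 * win.a)) (hw : 0 < zetaWeights p) {K : ℝ} (hK : 1 ≤ K)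
    {φ : ℝ} (hφ : 0 ≤ φ) {v : Fin win.N → ℝ} (hv : v ≠ 0) {ℓ τ : ℝ}
    (hℓ : v ⬝ᵥ (oddBlock zetaWeights win *ᵥ v) ≤ ℓ * (v ⬝ᵥ v))
    (hτ : τ * (v ⬝ᵥ v) ≤ oddAutocorr (2 * win.a) v (Real.log p))
    (ht : ℓ - bottomRayleigh (oddBlock zetaWeights win)
      < 2 * (K - 1) * zetaWeights p * (τ - (1 + Real.sqrt 5) / 4 - 2 * φ * win.N)) :
    datumOf (dial p K zetaWeights) ∉ floorNodelessEOAt φ win :=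
  servedWindow_upDial_not_mem_floorNodelessEOAt_of_threshold ha hp (two_le_of_zetaWeights_pos hw) hK hw.le hφ hv
    hℓ hτ ht

/-- SERVED-WINDOW SHAPE PINCER FOR ζ (no rung hypothesis): on a window with `a ≤ 4 log 2`, at every
prime power `p ∈ primeRange (2a)` with `0 < zetaWeights p`, one anti-correlated even test vector and one
positively odd-correlated test vector (odd correlation above the golden ceiling plus floor) confine the
dial values `K` keeping `datumOf (dial p K zetaWeights)` in the floored `eo` reader to a closed interval
around `1` (an OUTER bound; no membership inside the interval is asserted). [folklore] -/
theorem servedWindow_zeta_dial_mem_Icc_of_mem_floorNodelessEOAt {win : Window} (ha : win.a ≤ 4 * Real.log 2)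
    {p : ℕ} (hp : p ∈ primeRange (2 * win.a)) (hw : 0 < zetaWeights p) {φ : ℝ} (hφ : 0 ≤ φ)
    {v : Fin (win.N + 1) → ℝ} (hv : v ≠ 0) {ℓ σ : ℝ} (hℓ : v ⬝ᵥ (evenBlock zetaWeights win *ᵥ v) ≤ ℓ * (v ⬝ᵥ v))
    (hσ : autocorr (2 * win.a) v (Real.log p) ≤ -σ * (v ⬝ᵥ v)) (hσ' : 2 * φ * (2 * win.N + 1) < σ)
    {v' : Fin win.N → ℝ} (hv' : v' ≠ 0) {ℓ' τ : ℝ} (hℓ' : v' ⬝ᵥ (oddBlock zetaWeights win *ᵥ v') ≤ ℓ' * (v' ⬝ᵥ v'))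
    (hτ : τ * (v' ⬝ᵥ v') ≤ oddAutocorr (2 * win.a) v' (Real.log p))
    (hτ' : (1 + Real.sqrt 5) / 4 + 2 * φ * win.N < τ) {K : ℝ}
    (hK : datumOf (dial p K zetaWeights) ∈ floorNodelessEOAt φ win) :
    1 - (ℓ - bottomRayleigh (evenBlock zetaWeights win)) / (2 * zetaWeights p * (σ - 2 * φ * (2 * win.N + 1))) ≤ K ∧
      K ≤ 1 + (ℓ' - bottomRayleigh (oddBlock zetaWeights win))
        / (2 * zetaWeights p * (τ - ((1 + Real.sqrt 5) / 4 + 2 * φ * win.N))) :=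
  zeta_quarterDial_mem_Icc_of_mem_floorNodelessEOAt hp (quarter_rung_of_two_le ha (two_le_of_zetaWeights_pos hw)) hw hφ
    hv hℓ hσ hσ' hv' hℓ' hτ hτ' hK

/-- Uniform form over the whole prime range of a served window: the pincer interval at each reached
prime power with positive ζ weight, packaged as one `∀ p ∈ primeRange (2a)` statement with the witnesses
supplied pointwise. [folklore] -/
theorem servedWindow_zeta_dial_mem_Icc_forall {win : Window} (ha : win.a ≤ 4 * Real.log 2) {φ : ℝ} (hφ : 0 ≤ φ)
    (ℓ σ ℓ' τ : ℕ → ℝ)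
    (hev : ∀ p ∈ primeRange (2 * win.a), 0 < zetaWeights p → ∃ v : Fin (win.N + 1) → ℝ, v ≠ 0 ∧
      v ⬝ᵥ (evenBlock zetaWeights win *ᵥ v) ≤ ℓ p * (v ⬝ᵥ v) ∧
      autocorr (2 * win.a) v (Real.log p) ≤ -σ p * (v ⬝ᵥ v) ∧ 2 * φ * (2 * win.N + 1) < σ p)
    (hodd : ∀ p ∈ primeRange (2 * win.a), 0 < zetaWeights p → ∃ v' : Fin win.N → ℝ, v' ≠ 0 ∧
      v' ⬝ᵥ (oddBlock zetaWeights win *ᵥ v') ≤ ℓ' p * (v' ⬝ᵥ v') ∧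
      τ p * (v' ⬝ᵥ v') ≤ oddAutocorr (2 * win.a) v' (Real.log p) ∧ (1 + Real.sqrt 5) / 4 + 2 * φ * win.N < τ p) :
    ∀ p ∈ primeRange (2 * win.a), 0 < zetaWeights p → ∀ K : ℝ,
      datumOf (dial p K zetaWeights) ∈ floorNodelessEOAt φ win →
        1 - (ℓ p - bottomRayleigh (evenBlock zetaWeights win)) / (2 * zetaWeights p * (σ p - 2 * φ * (2 * win.N + 1))) ≤ K ∧
        K ≤ 1 + (ℓ' p - bottomRayleigh (oddBlock zetaWeights win))
          / (2 * zetaWeights p * (τ p - ((1 + Real.sqrt 5) / 4 + 2 * φ * win.N))) := by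
  intro p hp hw K hK
  obtain ⟨v, hv, hℓ, hσ, hσ'⟩ := hev p hp hw
  obtain ⟨v', hv', hℓ', hτ, hτ'⟩ := hodd p hp hw
  exact servedWindow_zeta_dial_mem_Icc_of_mem_floorNodelessEOAt ha hp hw hφ hv hℓ hσ hσ' hv' hℓ' hτ hτ' hK

end Summit.RiemannHypothesis.RiemannHypothesis.Theorems.PfPersistence
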